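import Literature.NumberTheory.Automorphic.ArchRankOneOrbitalFamilyParamCayley   -- ★ p851143 (F0P3a-p04): `exists_cayley_transport`, `nonempty_isComplex_infinitePlace_complex`; brings ★ `cayley_conj_circleDiagonal_mem_of_eq_over`, `isClosedEmbedding_coe_unitaryGroupOfForm_of_eq_over`
import Literature.NumberTheory.Automorphic.ArchLocalTorusOrbitalContinuity       -- ★ `isCompact_setOf_exists_conj_circleDiagonal_mem` (`[Field L]` only)
import Literature.MeasureTheory.Constructions.PiOptionIntegral                   -- ★ (LH10-p02): `integral_pi_of_isEmpty`
import HarnessLib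

/-!
# The `m`-fold Cayley-torus orbital tower on `U(J)^m`: empty base, vanishing, and the FUBINI PEEL `H (m+1) = Φ ∘ H m` (Fubini over `Measure.pi`; Rogawski 1990 §8.2; Varadarajan 1977 I §1.12)

Topic `NumberTheory/Automorphic`; namespace `Literature.NumberTheory.Automorphic.UnitaryGroup` (carrier `unitaryGroupOfForm (starRingEnd ℂ) J`, `hJ : J = (StdForm.antidiagonal 2).over ℂ`).
THEOREMS ONLY (no `def`, no instance, no notation, no axiom, no named fact, no `sorry`); kernel lane `--kind proof --supports stmt-HodgeConjecture-24833`.  Cell `pub/hodgecm-mathlib`,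
crux H413 (`stmt-HodgeConjecture-24833`), F0∕P3c line LH3 (closer stub `stub_N9`), LETTER L1 clause (I₁), organ O-L1e (X′-CORNERS), LH3-plan (g4) RULING #18 ∕ 11:13:39Z: brick **(J)
«FUBINI JUNCTION»** of (X3-asm) (binder of record F0P3a-p02 (g21), `contDiffOn_and_forall_bound_nestedReader`); pen LH7-p02 (g4).  Count-neutral.

THE MATHEMATICS.  (X3-asm) runs an induction over an ABSTRACT tower `H m P′ : (P′ × (Fin m → M) → E) → (P′ × (Fin m → ℝ) → E)` of «`m`-fold nested readers» with three sockets; the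
tower of record is the CLOSED FORM over the `m`-fold Cayley-torus orbital integral of (X2)'s `m`-block descent,
  `H m P′ f (q, ψ) = (∏ k, 2 sin ψ_k) • ∫_{U(J)^m} f (q, (↑↑(h_k · P diag(e^{iψ_k}, e^{−iψ_k}) P⁻¹ · h_k⁻¹))_k) d(⊗_k μ₀)`
(`P = (1 1; 1 −1)`, centre `1`; written as a lambda at the call site — this file states everything beta-reduced on it, so the sockets are discharged by `exact` up to βδ).
* §1 **`isCompact_setOf_conj_cayleyTorus_one_mem`** — at a regular angle (`sin ψ ≠ 0`) the set of `g ∈ U(J)` conjugating the torus point into a compact set of matrices is compact; FREE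
  of number-field binders on the abstract carrier: ★ `isCompact_setOf_exists_conj_circleDiagonal_mem` needs only `[Field L]`, so it is run at `L := ℂ` with its own complex place
  (★ `nonempty_isComplex_infinitePlace_complex`) on the engine carrier `U(σ diag(2,−2))` and transported along the Cayley isomorphism ★ `exists_cayley_transport`.
* §2 **`integrable_towerIntegrand`** — at regular angles the `m`-fold integrand `h ↦ f (q, (A (h k) (ψ k))_k)` of a continuous, block-compactly-supported `f (q, ·)` is integrable for
  `⊗_k μ₀` (support in the compact box `Π_k {g | A g ψ_k ∈ C}`; `⊗_k μ₀` is a Haar measure).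
* §3 THE SOCKETS: **`towerH_zero`** (`hH0`: `Measure.pi` over `Fin 0` is the Dirac mass — ★ `integral_pi_of_isEmpty`), **`towerH_eq_zero`** (`hHzero`), **`towerH_succ`** (`hHsucc`: PEEL the
  slot-`0` block — `Fin.prod_univ_succ`, Mathlib `measurePreserving_piFinSuccAbove (fun _ => μ₀) 0` + `integral_prod`, `Fin.cons`∕`Fin.tail`), for ANY functional `Φ` with the
  Cayley-at-centre-`1` clause `hΦ : Φ g ψ = (2 sin ψ) • ∫ g (A h ψ) dμ₀`.
HONEST LABEL: HC_CM is proved only modulo the 7 printed citations (2 remaining: hLiu418 = `stmt-HodgeConjecture-24832`, h413 = `stmt-HodgeConjecture-24833`) until rung 0 closes;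
measure-theoretic bookkeeping, pays nothing by itself.

## References
* [Rogawski1990] J. D. Rogawski, *Automorphic Representations of Unitary Groups in Three Variables*, Ann. of Math. Stud. 123 (1990), §8.2 pp. 119–123 (orbital integrals at the compact
  torus, place by place), §3.6 p. 31 (product measures).
* [Varadarajan1977] V. S. Varadarajan, *Harmonic Analysis on Real Reductive Groups*, LNM 576 (1977), Part I §1.12.
* [vanDoorn2021HaarMeasure] F. van Doorn, *Formalized Haar Measure*, ITP 2021, LIPIcs 193 (2021), §4 Thm. 3 (Fubini for the Bochner integral), §7 (finitary `Measure.pi`).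
* [DeitmarEchterhoff2014] A. Deitmar, S. Echterhoff, *Principles of Harmonic Analysis*, 2nd ed. (2014), Lemma 9.3.3 (compactness of the conjugating set).
-/

set_option autoImplicit false

noncomputable section

namespace Literature.NumberTheory.Automorphic

namespace UnitaryGroup

open _root_.MeasureTheory _root_.MeasureTheory.Measure _root_.Set _root_.Filter _root_.Topology _root_.Complex _root_.NumberField _root_.NumberField.InfinitePlace
open _root_.Literature.MeasureTheory.Constructions
open scoped MatrixGroups ContDiff Matrix.Norms.Operator

variable {J : Matrix (Fin 2) (Fin 2) ℂ} (hJ : J = (StdForm.antidiagonal 2).over ℂ)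
  [MeasurableSpace ↥(unitaryGroupOfForm (starRingEnd ℂ) J)] [BorelSpace ↥(unitaryGroupOfForm (starRingEnd ℂ) J)]

/-! ## §1 Compact conjugating set at a regular Cayley torus point, abstract carrier, no number-field binder -/

include hJ in
/-- **At a regular angle (`sin ψ ≠ 0`) the set `{g ∈ U(J)(ℂ) | ↑↑(g · P diag(e^{iψ}, e^{−iψ}) P⁻¹ · g⁻¹) ∈ C}` is compact** for every compact `C ⊆ M₂(ℂ)` — ★
`isCompact_setOf_exists_conj_circleDiagonal_mem` on the engine carrier `U(σ diag(2, −2))` at `L := ℂ` (its own complex place), transported along the Cayley isomorphism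
`e : h′ ↦ P h′ P⁻¹` (★ `exists_cayley_transport`); `U(J) ↪ M₂(ℂ)` is a closed embedding. [cite: Rogawski1990, §8.2 p. 122] [cite: DeitmarEchterhoff2014, Lemma 9.3.3] -/
theorem isCompact_setOf_conj_cayleyTorus_one_mem {ψ : ℝ} (hψ : Real.sin ψ ≠ 0) {C : Set (Matrix (Fin 2) (Fin 2) ℂ)} (hC : IsCompact C) :
    IsCompact {g : ↥(unitaryGroupOfForm (starRingEnd ℂ) J) |
      (((g * ⟨Matrix.GeneralLinearGroup.mkOfDetNeZero !![(1 : ℂ), 1; 1, -1] det_cayleyTwo_ne_zero * circleDiagonal 2 ![Circle.exp ψ, Circle.exp (-ψ)] *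
              (Matrix.GeneralLinearGroup.mkOfDetNeZero !![(1 : ℂ), 1; 1, -1] det_cayleyTwo_ne_zero)⁻¹, cayley_conj_circleDiagonal_mem_of_eq_over hJ _⟩ * g⁻¹ :
            ↥(unitaryGroupOfForm (starRingEnd ℂ) J)) : GL (Fin 2) ℂ) : Matrix (Fin 2) (Fin 2) ℂ) ∈ C} := by
  obtain ⟨w₀⟩ := nonempty_isComplex_infinitePlace_complex
  letI : MeasurableSpace ↥(unitaryGroupOfForm (starRingEnd ℂ) ((Matrix.diagonal ![(2 : ℂ), -2]).map (w₀.1.embedding : ℂ →+* ℂ))) := borel _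
  haveI : BorelSpace ↥(unitaryGroupOfForm (starRingEnd ℂ) ((Matrix.diagonal ![(2 : ℂ), -2]).map (w₀.1.embedding : ℂ →+* ℂ))) := ⟨rfl⟩
  obtain ⟨e, he, hγ, -⟩ := exists_cayley_transport (E := ℝ) hJ w₀
  have hce := isClosedEmbedding_coe_unitaryGroupOfForm_of_eq_over hJ
  have hα : ∀ i, (![(2 : ℂ), -2]) i ≠ 0 := by
    intro i; fin_cases i <;> simp
  -- the regular pair `(e^{iψ}, e^{−iψ})`
  have hinj : Function.Injective (![Circle.exp ψ, Circle.exp (-ψ)] : Fin 2 → Circle) := by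
    have hne : Circle.exp ψ ≠ Circle.exp (-ψ) := by
      intro h
      obtain ⟨m, hm⟩ := Circle.exp_eq_exp.1 h
      apply hψ
      rw [show ψ = (m : ℝ) * Real.pi by linarith]
      exact Real.sin_int_mul_pi m
    intro i j hij
    fin_cases i <;> fin_cases j
    · rfl
    · exact absurd hij hne
    · exact absurd hij.symm hne
    · rfl
  -- the transported compact target on the engine carrier
  set C' : Set ↥(unitaryGroupOfForm (starRingEnd ℂ) ((Matrix.diagonal ![(2 : ℂ), -2]).map (w₀.1.embedding : ℂ →+* ℂ))) :=
    e ⁻¹' ((fun g : ↥(unitaryGroupOfForm (starRingEnd ℂ) J) => ((g : GL (Fin 2) ℂ) : Matrix (Fin 2) (Fin 2) ℂ)) ⁻¹' C) with hC'_def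
  have hC' : IsCompact C' := e.toHomeomorph.isCompact_preimage.2 (hce.isCompact_preimage hC)
  have hK := isCompact_setOf_exists_conj_circleDiagonal_mem ℂ 2 ![(2 : ℂ), -2] w₀ hα (K := {![Circle.exp ψ, Circle.exp (-ψ)]}) isCompact_singleton
    (fun z hz => by rw [mem_singleton_iff.1 hz]; exact hinj) hC'
  -- the set is the image of the engine-side set under the homeomorphism `e`
  have hset : {g : ↥(unitaryGroupOfForm (starRingEnd ℂ) J) |
      (((g * ⟨Matrix.GeneralLinearGroup.mkOfDetNeZero !![(1 : ℂ), 1; 1, -1] det_cayleyTwo_ne_zero * circleDiagonal 2 ![Circle.exp ψ, Circle.exp (-ψ)] *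
              (Matrix.GeneralLinearGroup.mkOfDetNeZero !![(1 : ℂ), 1; 1, -1] det_cayleyTwo_ne_zero)⁻¹, cayley_conj_circleDiagonal_mem_of_eq_over hJ _⟩ * g⁻¹ :
            ↥(unitaryGroupOfForm (starRingEnd ℂ) J)) : GL (Fin 2) ℂ) : Matrix (Fin 2) (Fin 2) ℂ) ∈ C} =
      e '' {g' | ∃ z ∈ ({![Circle.exp ψ, Circle.exp (-ψ)]} : Set (Fin 2 → Circle)),
        g' * ⟨circleDiagonal 2 z, circleDiagonal_mem_archLocal_diagonal ℂ 2 ![(2 : ℂ), -2] w₀ z⟩ * g'⁻¹ ∈ C'} := by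
    ext g
    simp only [mem_setOf_eq, mem_image, mem_singleton_iff, exists_eq_left, hC'_def, mem_preimage]
    constructor
    · intro hg
      refine ⟨e.symm g, ?_, e.apply_symm_apply g⟩
      have hrw : e (e.symm g * ⟨circleDiagonal 2 ![Circle.exp ψ, Circle.exp (-ψ)],
            circleDiagonal_mem_archLocal_diagonal ℂ 2 ![(2 : ℂ), -2] w₀ _⟩ * (e.symm g)⁻¹) =
          g * ⟨Matrix.GeneralLinearGroup.mkOfDetNeZero !![(1 : ℂ), 1; 1, -1] det_cayleyTwo_ne_zero * circleDiagonal 2 ![Circle.exp ψ, Circle.exp (-ψ)] *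
              (Matrix.GeneralLinearGroup.mkOfDetNeZero !![(1 : ℂ), 1; 1, -1] det_cayleyTwo_ne_zero)⁻¹, cayley_conj_circleDiagonal_mem_of_eq_over hJ _⟩ * g⁻¹ := by
        simp only [map_mul, map_inv, ContinuousMulEquiv.apply_symm_apply, hγ]
      rw [hrw]
      exact hg
    · rintro ⟨g', hg', rfl⟩
      have hrw : e (g' * ⟨circleDiagonal 2 ![Circle.exp ψ, Circle.exp (-ψ)],
            circleDiagonal_mem_archLocal_diagonal ℂ 2 ![(2 : ℂ), -2] w₀ _⟩ * g'⁻¹) =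
          e g' * ⟨Matrix.GeneralLinearGroup.mkOfDetNeZero !![(1 : ℂ), 1; 1, -1] det_cayleyTwo_ne_zero * circleDiagonal 2 ![Circle.exp ψ, Circle.exp (-ψ)] *
              (Matrix.GeneralLinearGroup.mkOfDetNeZero !![(1 : ℂ), 1; 1, -1] det_cayleyTwo_ne_zero)⁻¹, cayley_conj_circleDiagonal_mem_of_eq_over hJ _⟩ * (e g')⁻¹ := by
        simp only [map_mul, map_inv, hγ]
      rw [hrw] at hg'
      exact hg'
  rw [hset]
  exact hK.image e.continuous

/-! ## §2 Integrability of the `m`-fold tower integrand at regular angles -/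

variable (μ₀ : Measure ↥(unitaryGroupOfForm (starRingEnd ℂ) J))
  {E : Type*} [NormedAddCommGroup E] [NormedSpace ℝ E]

omit [NormedSpace ℝ E] in
include hJ in
/-- **The `m`-fold tower integrand is continuous with compact support, hence integrable** at regular angles: for `F : (Fin m → M₂(ℂ)) → E` continuous and vanishing as soon as one block
variable leaves the compact `C`, `h ↦ F ((A (h k) (ψ k))_k)` vanishes off the compact box `Π_k {g | A g ψ_k ∈ C}` (§1), so it is integrable for the Haar measure `⊗_k μ₀` on `U(J)^m`.
[cite: Rogawski1990, §8.2 p. 122] [cite: vanDoorn2021HaarMeasure, §7] -/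
theorem integrable_towerIntegrand [LocallyCompactSpace ↥(unitaryGroupOfForm (starRingEnd ℂ) J)] [SecondCountableTopology ↥(unitaryGroupOfForm (starRingEnd ℂ) J)]
    [μ₀.IsHaarMeasure] {m : ℕ}
    (F : (Fin m → Matrix (Fin 2) (Fin 2) ℂ) → E) (hF : Continuous F)
    {C : Set (Matrix (Fin 2) (Fin 2) ℂ)} (hC : IsCompact C) (hFC : ∀ X : Fin m → Matrix (Fin 2) (Fin 2) ℂ, (∃ k, X k ∉ C) → F X = 0)
    (ψ : Fin m → ℝ) (hψ : ∀ k, Real.sin (ψ k) ≠ 0) :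
    Integrable (fun h : Fin m → ↥(unitaryGroupOfForm (starRingEnd ℂ) J) =>
        F (fun k => (((h k * ⟨Matrix.GeneralLinearGroup.mkOfDetNeZero !![(1 : ℂ), 1; 1, -1] det_cayleyTwo_ne_zero *
              circleDiagonal 2 ![Circle.exp (ψ k), Circle.exp (-(ψ k))] *
              (Matrix.GeneralLinearGroup.mkOfDetNeZero !![(1 : ℂ), 1; 1, -1] det_cayleyTwo_ne_zero)⁻¹, cayley_conj_circleDiagonal_mem_of_eq_over hJ _⟩ * (h k)⁻¹ :
            ↥(unitaryGroupOfForm (starRingEnd ℂ) J)) : GL (Fin 2) ℂ) : Matrix (Fin 2) (Fin 2) ℂ)))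
      (Measure.pi fun _ : Fin m => μ₀) := by
  have hce := isClosedEmbedding_coe_unitaryGroupOfForm_of_eq_over hJ
  -- continuity of the block map `h ↦ (A (h k) (ψ k))_k`
  have hA : Continuous fun h : Fin m → ↥(unitaryGroupOfForm (starRingEnd ℂ) J) => fun k =>
      (((h k * ⟨Matrix.GeneralLinearGroup.mkOfDetNeZero !![(1 : ℂ), 1; 1, -1] det_cayleyTwo_ne_zero *
            circleDiagonal 2 ![Circle.exp (ψ k), Circle.exp (-(ψ k))] *
            (Matrix.GeneralLinearGroup.mkOfDetNeZero !![(1 : ℂ), 1; 1, -1] det_cayleyTwo_ne_zero)⁻¹, cayley_conj_circleDiagonal_mem_of_eq_over hJ _⟩ * (h k)⁻¹ :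
          ↥(unitaryGroupOfForm (starRingEnd ℂ) J)) : GL (Fin 2) ℂ) : Matrix (Fin 2) (Fin 2) ℂ) :=
    continuous_pi fun k => hce.continuous.comp ((((continuous_apply k).mul continuous_const)).mul (continuous_apply k).inv)
  refine (hF.comp hA).integrable_of_hasCompactSupport ?_
  -- support in the compact box `Π_k S_k`
  have hS : ∀ k, IsCompact {g : ↥(unitaryGroupOfForm (starRingEnd ℂ) J) |
      (((g * ⟨Matrix.GeneralLinearGroup.mkOfDetNeZero !![(1 : ℂ), 1; 1, -1] det_cayleyTwo_ne_zero * circleDiagonal 2 ![Circle.exp (ψ k), Circle.exp (-(ψ k))] *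
              (Matrix.GeneralLinearGroup.mkOfDetNeZero !![(1 : ℂ), 1; 1, -1] det_cayleyTwo_ne_zero)⁻¹, cayley_conj_circleDiagonal_mem_of_eq_over hJ _⟩ * g⁻¹ :
            ↥(unitaryGroupOfForm (starRingEnd ℂ) J)) : GL (Fin 2) ℂ) : Matrix (Fin 2) (Fin 2) ℂ) ∈ C} :=
    fun k => isCompact_setOf_conj_cayleyTorus_one_mem hJ (hψ k) hC
  refine HasCompactSupport.intro (isCompact_univ_pi hS) fun h hh => ?_
  simp only [mem_univ_pi, mem_setOf_eq, not_forall] at hh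
  obtain ⟨k, hk⟩ := hh
  exact hFC _ ⟨k, hk⟩

/-! ## §3 The three sockets of the (X3-asm) tower: empty base, vanishing, Fubini peel -/

variable [CompleteSpace E]

include hJ in
omit [BorelSpace ↥(unitaryGroupOfForm (starRingEnd ℂ) J)] in
/-- **`hH0` — EMPTY BASE**: over `Fin 0` the product of sines is `1` and `Measure.pi` is the Dirac mass at the empty tuple (★ `integral_pi_of_isEmpty`), so
`H 0 P′ f (q, ψ) = f (q, Fin.elim0)`. [cite: vanDoorn2021HaarMeasure, §7] -/
theorem towerH_zero (P' : Type*) (f : P' × (Fin 0 → Matrix (Fin 2) (Fin 2) ℂ) → E) (q : P') (ψ : Fin 0 → ℝ) :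
    (∏ k, 2 * Real.sin (ψ k)) • ∫ h : Fin 0 → ↥(unitaryGroupOfForm (starRingEnd ℂ) J),
        f (q, fun k => (((h k * ⟨Matrix.GeneralLinearGroup.mkOfDetNeZero !![(1 : ℂ), 1; 1, -1] det_cayleyTwo_ne_zero *
              circleDiagonal 2 ![Circle.exp (ψ k), Circle.exp (-(ψ k))] *
              (Matrix.GeneralLinearGroup.mkOfDetNeZero !![(1 : ℂ), 1; 1, -1] det_cayleyTwo_ne_zero)⁻¹, cayley_conj_circleDiagonal_mem_of_eq_over hJ _⟩ * (h k)⁻¹ :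
            ↥(unitaryGroupOfForm (starRingEnd ℂ) J)) : GL (Fin 2) ℂ) : Matrix (Fin 2) (Fin 2) ℂ)) ∂(Measure.pi fun _ : Fin 0 => μ₀) =
      f (q, fun k => k.elim0) := by
  rw [Finset.univ_eq_empty, Finset.prod_empty, one_smul, integral_pi_of_isEmpty]
  congr 1
  exact congrArg _ (funext fun k => k.elim0)

include hJ in
omit [BorelSpace ↥(unitaryGroupOfForm (starRingEnd ℂ) J)] [CompleteSpace E] in
/-- **`hHzero` — VANISHING**: if `f (q, ·) ≡ 0` then `H m P′ f (q, ψ) = 0`. [cite: vanDoorn2021HaarMeasure, §4 Thm. 3] -/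
theorem towerH_eq_zero (m : ℕ) (P' : Type*) (f : P' × (Fin m → Matrix (Fin 2) (Fin 2) ℂ) → E) (q : P') (ψ : Fin m → ℝ) (h0 : ∀ X, f (q, X) = 0) :
    (∏ k, 2 * Real.sin (ψ k)) • ∫ h : Fin m → ↥(unitaryGroupOfForm (starRingEnd ℂ) J),
        f (q, fun k => (((h k * ⟨Matrix.GeneralLinearGroup.mkOfDetNeZero !![(1 : ℂ), 1; 1, -1] det_cayleyTwo_ne_zero *
              circleDiagonal 2 ![Circle.exp (ψ k), Circle.exp (-(ψ k))] *
              (Matrix.GeneralLinearGroup.mkOfDetNeZero !![(1 : ℂ), 1; 1, -1] det_cayleyTwo_ne_zero)⁻¹, cayley_conj_circleDiagonal_mem_of_eq_over hJ _⟩ * (h k)⁻¹ :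
            ↥(unitaryGroupOfForm (starRingEnd ℂ) J)) : GL (Fin 2) ℂ) : Matrix (Fin 2) (Fin 2) ℂ)) ∂(Measure.pi fun _ : Fin m => μ₀) = 0 := by
  simp only [h0, integral_zero, smul_zero]

omit [CompleteSpace E] in
include hJ in
/-- **`hHsucc` — THE FUBINI PEEL**: for `f` smooth on `Q ×ˢ univ` (`Q` open), vanishing as soon as one block variable leaves a compact `C`, `q ∈ Q` and REGULAR angles `ψ`, the
`(m+1)`-fold tower is the Cayley-at-centre-`1` functional `Φ` (clause `hΦ`) of the slot-`0` block applied to the `m`-fold tower of the re-indexed family `f̃ ((q, X₀), X′) = f (q, Fin.cons X₀ X′)`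
at `((q, X₀), Fin.tail ψ)`: `Fin.prod_univ_succ` for the sines, Mathlib `measurePreserving_piFinSuccAbove (fun _ => μ₀) 0` (`(Fin (m+1) → U(J)) ≃ᵐ U(J) × (Fin m → U(J))`, inverse
`Fin.cons`) and `integral_prod` (integrability §2). [cite: Rogawski1990, §8.2 p. 122] [cite: vanDoorn2021HaarMeasure, §4 Thm. 3] [cite: Varadarajan1977, I §1.12] -/
theorem towerH_succ [LocallyCompactSpace ↥(unitaryGroupOfForm (starRingEnd ℂ) J)] [SecondCountableTopology ↥(unitaryGroupOfForm (starRingEnd ℂ) J)] [μ₀.IsHaarMeasure]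
    (Φ : (Matrix (Fin 2) (Fin 2) ℂ → E) → ℝ → E)
    (hΦ : ∀ (g : Matrix (Fin 2) (Fin 2) ℂ → E) (ψ : ℝ), Φ g ψ = (2 * Real.sin ψ) • ∫ h : ↥(unitaryGroupOfForm (starRingEnd ℂ) J),
      g (((h * ⟨Matrix.GeneralLinearGroup.mkOfDetNeZero !![(1 : ℂ), 1; 1, -1] det_cayleyTwo_ne_zero * circleDiagonal 2 ![Circle.exp ψ, Circle.exp (-ψ)] *
              (Matrix.GeneralLinearGroup.mkOfDetNeZero !![(1 : ℂ), 1; 1, -1] det_cayleyTwo_ne_zero)⁻¹, cayley_conj_circleDiagonal_mem_of_eq_over hJ _⟩ * h⁻¹ :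
            ↥(unitaryGroupOfForm (starRingEnd ℂ) J)) : GL (Fin 2) ℂ) : Matrix (Fin 2) (Fin 2) ℂ) ∂μ₀)
    (m : ℕ) (P' : Type*) [NormedAddCommGroup P'] [NormedSpace ℝ P'] (Q : Set P') (_hQ : IsOpen Q)
    (f : P' × (Fin (m + 1) → Matrix (Fin 2) (Fin 2) ℂ) → E) (hf : ContDiffOn ℝ ∞ f (Q ×ˢ univ))
    (hC : ∃ C : Set (Matrix (Fin 2) (Fin 2) ℂ), IsCompact C ∧ ∀ (q : P') (X : Fin (m + 1) → Matrix (Fin 2) (Fin 2) ℂ), (∃ k, X k ∉ C) → f (q, X) = 0)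
    (q : P') (hq : q ∈ Q) (ψ : Fin (m + 1) → ℝ) (hψ : ∀ k, Real.sin (ψ k) ≠ 0) :
    (∏ k, 2 * Real.sin (ψ k)) • ∫ h : Fin (m + 1) → ↥(unitaryGroupOfForm (starRingEnd ℂ) J),
        f (q, fun k => (((h k * ⟨Matrix.GeneralLinearGroup.mkOfDetNeZero !![(1 : ℂ), 1; 1, -1] det_cayleyTwo_ne_zero *
              circleDiagonal 2 ![Circle.exp (ψ k), Circle.exp (-(ψ k))] *
              (Matrix.GeneralLinearGroup.mkOfDetNeZero !![(1 : ℂ), 1; 1, -1] det_cayleyTwo_ne_zero)⁻¹, cayley_conj_circleDiagonal_mem_of_eq_over hJ _⟩ * (h k)⁻¹ :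
            ↥(unitaryGroupOfForm (starRingEnd ℂ) J)) : GL (Fin 2) ℂ) : Matrix (Fin 2) (Fin 2) ℂ)) ∂(Measure.pi fun _ : Fin (m + 1) => μ₀) =
      Φ (fun X₀ => (∏ k, 2 * Real.sin (Fin.tail ψ k)) • ∫ h : Fin m → ↥(unitaryGroupOfForm (starRingEnd ℂ) J),
          (fun p : (P' × Matrix (Fin 2) (Fin 2) ℂ) × (Fin m → Matrix (Fin 2) (Fin 2) ℂ) => f (p.1.1, Fin.cons p.1.2 p.2))
            ((q, X₀), fun k => (((h k * ⟨Matrix.GeneralLinearGroup.mkOfDetNeZero !![(1 : ℂ), 1; 1, -1] det_cayleyTwo_ne_zero *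
                  circleDiagonal 2 ![Circle.exp (Fin.tail ψ k), Circle.exp (-(Fin.tail ψ k))] *
                  (Matrix.GeneralLinearGroup.mkOfDetNeZero !![(1 : ℂ), 1; 1, -1] det_cayleyTwo_ne_zero)⁻¹, cayley_conj_circleDiagonal_mem_of_eq_over hJ _⟩ * (h k)⁻¹ :
                ↥(unitaryGroupOfForm (starRingEnd ℂ) J)) : GL (Fin 2) ℂ) : Matrix (Fin 2) (Fin 2) ℂ)) ∂(Measure.pi fun _ : Fin m => μ₀))
        (ψ 0) := by
  obtain ⟨C, hCc, hfC⟩ := hC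
  -- abbreviations: the torus point and the conjugation map at an angle
  set T : ℝ → ↥(unitaryGroupOfForm (starRingEnd ℂ) J) := fun θ =>
    ⟨Matrix.GeneralLinearGroup.mkOfDetNeZero !![(1 : ℂ), 1; 1, -1] det_cayleyTwo_ne_zero * circleDiagonal 2 ![Circle.exp θ, Circle.exp (-θ)] *
        (Matrix.GeneralLinearGroup.mkOfDetNeZero !![(1 : ℂ), 1; 1, -1] det_cayleyTwo_ne_zero)⁻¹, cayley_conj_circleDiagonal_mem_of_eq_over hJ _⟩ with hT_def
  set A : ↥(unitaryGroupOfForm (starRingEnd ℂ) J) → ℝ → Matrix (Fin 2) (Fin 2) ℂ := fun g θ =>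
    (((g * T θ * g⁻¹ : ↥(unitaryGroupOfForm (starRingEnd ℂ) J)) : GL (Fin 2) ℂ) : Matrix (Fin 2) (Fin 2) ℂ) with hA_def
  -- `f (q, ·)` is continuous
  have hfq : Continuous fun X : Fin (m + 1) → Matrix (Fin 2) (Fin 2) ℂ => f (q, X) :=
    hf.continuousOn.comp_continuous (continuous_const.prodMk continuous_id) fun X => ⟨hq, mem_univ _⟩
  -- the `(m+1)`-fold integrand is integrable (§2)
  have hInt : Integrable (fun h : Fin (m + 1) → ↥(unitaryGroupOfForm (starRingEnd ℂ) J) => f (q, fun k => A (h k) (ψ k)))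
      (Measure.pi fun _ : Fin (m + 1) => μ₀) :=
    integrable_towerIntegrand hJ μ₀ (fun X => f (q, X)) hfq hCc (fun X hX => hfC q X hX) ψ hψ
  -- the peel `(Fin (m+1) → G) ≃ᵐ G × (Fin m → G)` is measure preserving
  have hmp := (measurePreserving_piFinSuccAbove (fun _ : Fin (m + 1) => μ₀) 0).symm _
  have hsymm : ∀ p : ↥(unitaryGroupOfForm (starRingEnd ℂ) J) × (Fin m → ↥(unitaryGroupOfForm (starRingEnd ℂ) J)),
      (MeasurableEquiv.piFinSuccAbove (fun _ : Fin (m + 1) => ↥(unitaryGroupOfForm (starRingEnd ℂ) J)) 0).symm p =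
        (Fin.cons p.1 p.2 : Fin (m + 1) → ↥(unitaryGroupOfForm (starRingEnd ℂ) J)) := fun p => by
    show Fin.insertNth 0 p.1 p.2 = (Fin.cons p.1 p.2 : Fin (m + 1) → ↥(unitaryGroupOfForm (starRingEnd ℂ) J))
    exact Fin.insertNth_zero' p.1 p.2
  -- change variables, then Fubini
  have hcv := hmp.integral_comp' (fun h : Fin (m + 1) → ↥(unitaryGroupOfForm (starRingEnd ℂ) J) => f (q, fun k => A (h k) (ψ k)))
  have hInt' : Integrable (fun p : ↥(unitaryGroupOfForm (starRingEnd ℂ) J) × (Fin m → ↥(unitaryGroupOfForm (starRingEnd ℂ) J)) =>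
      f (q, fun k => A ((Fin.cons p.1 p.2 : Fin (m + 1) → ↥(unitaryGroupOfForm (starRingEnd ℂ) J)) k) (ψ k)))
      (μ₀.prod (Measure.pi fun _ : Fin m => μ₀)) := by
    have h := (hmp.integrable_comp_emb (MeasurableEquiv.measurableEmbedding _)).2 hInt
    refine h.congr (Filter.Eventually.of_forall fun p => ?_)
    simp only [Function.comp_apply, hsymm]
  -- slot bookkeeping: `k ↦ A (cons h₀ h′ k) (ψ k) = cons (A h₀ (ψ 0)) (k ↦ A (h′ k) (ψ k.succ))`
  have hcons : ∀ (h₀ : ↥(unitaryGroupOfForm (starRingEnd ℂ) J)) (h' : Fin m → ↥(unitaryGroupOfForm (starRingEnd ℂ) J)),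
      (fun k => A ((Fin.cons h₀ h' : Fin (m + 1) → ↥(unitaryGroupOfForm (starRingEnd ℂ) J)) k) (ψ k)) =
        Fin.cons (A h₀ (ψ 0)) (fun k => A (h' k) (Fin.tail ψ k)) := by
    intro h₀ h'
    funext k
    refine Fin.cases ?_ (fun j => ?_) k
    · simp only [Fin.cons_zero]
    · simp only [Fin.cons_succ, Fin.tail]
  -- assemble
  rw [hΦ, ← hcv, Fin.prod_univ_succ]
  simp_rw [hsymm]
  rw [integral_prod _ hInt']
  simp_rw [hcons]
  rw [integral_smul, smul_smul]
  rfl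

end UnitaryGroup

end Literature.NumberTheory.Automorphic

end
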